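import Mathlib.Analysis.InnerProductSpace.Calculus
import Mathlib.Analysis.Calculus.Deriv.MeanValue
import Mathlib.Analysis.Calculus.MeanValue
import Mathlib.Analysis.Calculus.ContDiff.Deriv
import Mathlib.Analysis.SpecialFunctions.Sqrt
import Literature.Geometry.Lorentzian.Basic
import HarnessLib

/-!
# Stub `stub_twoBodyEscape` of line `dilated-leaves-virial-certificate` of crux `Capture`
# (stmt-FinalStateConjecture-10115): two-body escape, the virial certificate as real analysis

The line `dilated-leaves-virial-certificate` of the crux `Capture` (routes `BartnikGapSettling` /
`QuietWindowCapture`, summit `FinalStateConjecture`) reads the crux's "an `ε`-fine near-Kerr leaf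
beyond every compact `K`" as a RECURRENCE CERTIFICATE: all-pairs-dilated epochs of the holes recur
forever.  This file proves the pair sector's kinematic heart, registered stub `stub_twoBodyEscape`
of `Summits/FinalStateConjecture/FinalStateConjecture/Cruxes/Capture/Lines/
dilated_leaves_virial_certificate.lean` (verbatim signature), as PURE REAL ANALYSIS (no relativity):
a `C²` relative orbit `x : ℝ → ℝ³`, collision-free and of bounded speed `‖ẋ‖ ≤ V` after `T`,
obeying the perturbed Kepler law `‖ẍ + μ x/‖x‖³‖ ≤ κ (μ/‖x‖²)(‖ẋ‖² + μ/‖x‖) + β(t)` with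
post-Newtonian-shaped slack and external forcing `β ≥ 0`, `t² β(t) → 0`; an energy LEDGER `E`,
non-increasing on `[T, ∞)` and accurate to PN-relative order,
`|E − (‖ẋ‖²/2 − μ/‖x‖)| ≤ κ (‖ẋ‖² + μ/‖x‖)(μ/‖x‖)`; and RECURRENT DILATION (`‖x‖ ≥ D'` at
arbitrarily late times, every `D'`).  Conclusion: `‖x(t)‖ → ∞`.

Proof (Lagrange–Jacobi convexity, Marchal–Saari 1976, §1), with `d = ‖x‖`, `v = ‖ẋ‖`,
`F = ‖x‖²`, `G = ⟪x, ẋ⟫ = F'/2`, `G' = v² + ⟪x, ẍ⟫`: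
1. `E ≥ 0` on `[T, ∞)` (`ledger_nonneg`): `E t ≥ E t'` for a later dilated `t'`, where the ledger
   is `≥ −μ/D' − κ(V² + μ/D')(μ/D') → 0`.  This is the ONLY use of antitonicity, and it is
   essential (Kepler plus integrable forcing admits orbits with `lim sup d = ∞`, `lim inf d < ∞`).
2. far states are unbound (`speed_sq_lower`): `d ≥ 10κμ ⟹ v² ≥ (3/2) μ/d`.
3. Lagrange–Jacobi sign (`inner_accel_nonneg`): there `G' ≥ v²(1−u) − (μ/d)(1+u) − dβ ≥ μ/(4d) − dβ`
   (`u = κμ/d ≤ 1/10`), which is `≥ 0` once `d² β ≤ μ/4`; the latter holds at all late times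
   (`lateness`: `d(t) ≤ L t` by the mean value inequality and `t² β → 0`).
4. no far return (`no_return`, real induction `IsClosed.Icc_subset_of_forall_mem_nhdsWithin`): from
   a far time `t₁` with `G t₁ ≥ 0` on, `G ≥ G t₁` and `F ≥ F t₁`; with `G t₁ > 0`,
   `F ≥ F t₁ + 2 G(t₁)(t − t₁) → ∞` (`tendsto_atTop_of_deriv`).
5. such a `t₁` exists (`exists_far_outgoing`): two recurrence times `t₂ ≤ t₃` with `F t₂ < F t₃`,
   the last exit `s₀ = sup {s ∈ [t₂, t₃] : F s ≤ F t₂}` and the mean value theorem on `[s₀, t₃]`.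
No named facts are used; no definitions are introduced; helpers are `private`.

References: C. Marchal, D. Saari, J. Differential Equations 20 (1976), §1 (Lagrange–Jacobi);
the skeleton's module docstring for the role of the stub in `Capture_of`.
-/

-- the doubled `FinalStateConjecture.FinalStateConjecture` path component trips dupNamespace
set_option linter.dupNamespace false

noncomputable section

namespace Summit.FinalStateConjecture.FinalStateConjecture.Theorems.BartnikGapSettling.Capture

open Set Filter Topology RealInnerProductSpace
open Literature.Geometry.Lorentzian

namespace TwoBodyEscape

/-! ### Algebra: far states are unbound, and the Lagrange–Jacobi sign -/

/-- **Far states are unbound.** If the ledger value `e ≥ 0` is `κ (v² + μ/d)(μ/d)`-close to the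
Kepler energy `v²/2 − μ/d` and `d ≥ 10 κ μ` (so `u = κμ/d ≤ 1/10`), then
`v² ≥ (2μ/d)(1 − u)/(1 + 2u) ≥ (3/2) μ/d`.  Step 2 of the Lagrange–Jacobi escape argument.
[cite: MarchalSaari1976, §1 (Lagrange–Jacobi)] -/
private theorem speed_sq_lower {μ κ d v e : ℝ} (hμ : 0 ≤ μ) (hd : 0 < d)
    (hfar : 10 * (κ * μ) ≤ d) (he : 0 ≤ e)
    (hled : |e - (v ^ 2 / 2 - μ / d)| ≤ κ * (v ^ 2 + μ / d) * (μ / d)) :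
    3 / 2 * (μ / d) ≤ v ^ 2 := by
  set m := μ / d with hm
  have hm0 : 0 ≤ m := div_nonneg hμ hd.le
  have hu : κ * m ≤ 1 / 10 := by
    rw [hm, ← mul_div_assoc, div_le_iff₀ hd]
    linarith
  have h1 : κ * m * v ^ 2 ≤ 1 / 10 * v ^ 2 := mul_le_mul_of_nonneg_right hu (sq_nonneg v)
  have h2 : κ * m * m ≤ 1 / 10 * m := mul_le_mul_of_nonneg_right hu hm0
  have h3 : e - (v ^ 2 / 2 - m) ≤ κ * (v ^ 2 + m) * m := (le_abs_self _).trans hled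
  nlinarith [h1, h2, h3, he]

/-- **Lagrange–Jacobi sign in the far late region.** For a position `y ≠ 0` with
`‖y‖ ≥ 10 κ μ`, an acceleration `a` obeying the perturbed Kepler law with slack
`κ (μ/‖y‖²)(v² + μ/‖y‖) + b`, an unbound speed `v² ≥ (3/2) μ/‖y‖` and small forcing
`‖y‖² b ≤ μ/4`, the second derivative of `‖x‖²/2` is nonnegative: `0 ≤ v² + ⟪y, a⟫`
(indeed `≥ μ/(4‖y‖) − ‖y‖ b`).  Step 3 of the Lagrange–Jacobi escape argument.
[cite: MarchalSaari1976, §1 (Lagrange–Jacobi)] -/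
private theorem inner_accel_nonneg {μ κ b v : ℝ} {y a : E3} (hμ : 0 ≤ μ) (hy : y ≠ 0)
    (hfar : 10 * (κ * μ) ≤ ‖y‖)
    (hforce : ‖a + (μ / ‖y‖ ^ 3) • y‖ ≤ κ * (μ / ‖y‖ ^ 2 * (v ^ 2 + μ / ‖y‖)) + b)
    (hv : 3 / 2 * (μ / ‖y‖) ≤ v ^ 2) (hb : ‖y‖ ^ 2 * b ≤ μ / 4) :
    0 ≤ v ^ 2 + ⟪y, a⟫ := by
  set d := ‖y‖ with hd
  have hd0 : 0 < d := norm_pos_iff.2 hy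
  set m := μ / d with hm
  have hm0 : 0 ≤ m := div_nonneg hμ hd0.le
  have hu : κ * m ≤ 1 / 10 := by
    rw [hm, ← mul_div_assoc, div_le_iff₀ hd0]
    linarith
  set p := a + (μ / d ^ 3) • y with hp
  -- `⟪y, a⟫ = ⟪y, p⟫ − μ/d`
  have hinner : ⟪y, a⟫ = ⟪y, p⟫ - m := by
    have h1 : ⟪y, p⟫ = ⟪y, a⟫ + μ / d ^ 3 * d ^ 2 := by
      rw [hp, inner_add_right, inner_smul_right, real_inner_self_eq_norm_sq]
    rw [h1, hm]
    field_simp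
    ring
  -- Cauchy–Schwarz and the force law: `-⟪y, p⟫ ≤ d ‖p‖ ≤ κ m (v² + m) + d b`
  have hcs : -(d * ‖p‖) ≤ ⟪y, p⟫ := (abs_le.1 (abs_real_inner_le_norm y p)).1
  have hpb : d * ‖p‖ ≤ κ * m * (v ^ 2 + m) + d * b := by
    have h1 := mul_le_mul_of_nonneg_left hforce hd0.le
    have e1 : d * (κ * (μ / d ^ 2 * (v ^ 2 + μ / d)) + b) = κ * m * (v ^ 2 + m) + d * b := by
      rw [hm]
      field_simp
    linarith [h1, e1]
  have hdb : d * b ≤ m / 4 := by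
    have e2 : d * (d * b) ≤ d * (m / 4) := by
      have h1 : d * (d * b) = d ^ 2 * b := by ring
      have h2 : d * (m / 4) = μ / 4 := by
        rw [hm]
        field_simp
      rw [h1, h2]
      exact hb
    exact le_of_mul_le_mul_left e2 hd0
  have h1 : κ * m * v ^ 2 ≤ 1 / 10 * v ^ 2 := mul_le_mul_of_nonneg_right hu (sq_nonneg v)
  have h2 : κ * m * m ≤ 1 / 10 * m := mul_le_mul_of_nonneg_right hu hm0
  rw [hinner]
  nlinarith [hcs, hpb, hdb, h1, h2, hv]

/-! ### Calculus of the virial `G = ⟪x, ẋ⟫` (`F = ‖x‖²` is `HasDerivAt.norm_sq`) -/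

/-- Derivative of the virial `t ↦ ⟪x t, ẋ t⟫` along a twice differentiable curve:
`‖ẋ t‖² + ⟪x t, ẍ t⟫` (Lagrange–Jacobi identity). [folklore] -/
private theorem hasDerivAt_inner_deriv {x : ℝ → E3} (hx : Differentiable ℝ x)
    (hx' : Differentiable ℝ (deriv x)) (t : ℝ) :
    HasDerivAt (fun s => ⟪x s, deriv x s⟫)
      (‖deriv x t‖ ^ 2 + ⟪x t, deriv (deriv x) t⟫) t := by
  refine ((hx t).hasDerivAt.inner ℝ (hx' t).hasDerivAt).congr_deriv ?_
  rw [real_inner_self_eq_norm_sq]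
  ring

/-! ### Real induction: no far return, escape, a far outgoing time -/

/-- **No far return (real induction).** Let `F' = 2G`, `G' = g` and suppose `g ≥ 0` whenever
`t ≥ a` and `F t > R` (the far region).  If `F a > R` and `G a ≥ 0`, then `G ≥ G a` and
`F ≥ F a` on `[a, ∞)`: the set `{G ≥ G a ∧ F ≥ F a}` is closed and, by continuity of `F` and the
two monotonicity statements on a short interval, a right-neighbourhood of each of its points
(`IsClosed.Icc_subset_of_forall_mem_nhdsWithin`).  Step 4 of the Lagrange–Jacobi escape argument.
[cite: MarchalSaari1976, §1 (Lagrange–Jacobi)] -/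
private theorem no_return {F G g : ℝ → ℝ} {a R : ℝ} (hF : ∀ t, HasDerivAt F (2 * G t) t)
    (hG : ∀ t, HasDerivAt G (g t) t) (hpos : ∀ t, a ≤ t → R < F t → 0 ≤ g t)
    (ha : R < F a) (hGa : 0 ≤ G a) : ∀ t, a ≤ t → G a ≤ G t ∧ F a ≤ F t := by
  have hFc : Continuous F := continuous_iff_continuousAt.2 fun t => (hF t).continuousAt
  have hGc : Continuous G := continuous_iff_continuousAt.2 fun t => (hG t).continuousAt
  intro b hab
  set s : Set ℝ := {t | G a ≤ G t ∧ F a ≤ F t} with hs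
  have hsc : IsClosed s :=
    (isClosed_le continuous_const hGc).inter (isClosed_le continuous_const hFc)
  suffices h : Icc a b ⊆ s from h (right_mem_Icc.2 hab)
  refine (hsc.inter isClosed_Icc).Icc_subset_of_forall_mem_nhdsWithin ⟨le_rfl, le_rfl⟩ ?_
  rintro y ⟨⟨hGy, hFy⟩, hay, -⟩
  -- `R < F` on a neighbourhood of `y`
  have hev : ∀ᶠ t in 𝓝 y, R < F t :=
    hFc.continuousAt.eventually (eventually_gt_nhds (ha.trans_le hFy))
  obtain ⟨ε, hε, hball⟩ := Metric.eventually_nhds_iff.1 hev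
  have hI : ∀ t ∈ Icc y (y + ε / 2), R < F t := fun t ht =>
    hball (by rw [Real.dist_eq, abs_of_nonneg (by linarith [ht.1])]; linarith [ht.2])
  -- `G` is monotone on `[y, y + ε/2]`, hence `≥ G a` there
  have hGmono : MonotoneOn G (Icc y (y + ε / 2)) :=
    monotoneOn_of_hasDerivWithinAt_nonneg (convex_Icc _ _) hGc.continuousOn
      (fun t _ => (hG t).hasDerivWithinAt) fun t ht => by
        rw [interior_Icc] at ht
        exact hpos t (hay.trans ht.1.le) (hI t (Ioo_subset_Icc_self ht))
  have hGge : ∀ t ∈ Icc y (y + ε / 2), G a ≤ G t := fun t ht =>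
    hGy.trans (hGmono (left_mem_Icc.2 (by linarith)) ht ht.1)
  -- so `F' = 2G ≥ 0` there and `F` is monotone on `[y, y + ε/2]`
  have hFmono : MonotoneOn F (Icc y (y + ε / 2)) :=
    monotoneOn_of_hasDerivWithinAt_nonneg (convex_Icc _ _) hFc.continuousOn
      (fun t _ => (hF t).hasDerivWithinAt) fun t ht => by
        rw [interior_Icc] at ht
        exact mul_nonneg zero_le_two (hGa.trans (hGge t (Ioo_subset_Icc_self ht)))
  have hsub : Icc y (y + ε / 2) ⊆ s := fun t ht =>
    ⟨hGge t ht, hFy.trans (hFmono (left_mem_Icc.2 (by linarith)) ht ht.1)⟩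
  exact mem_of_superset (Icc_mem_nhdsGT (by linarith)) hsub

/-- **Escape.** If `F' = 2G` and `G ≥ c > 0` on `[a, ∞)`, then `F t ≥ F a + 2c (t − a) → +∞`.
[folklore] -/
private theorem tendsto_atTop_of_deriv {F G : ℝ → ℝ} {a c : ℝ}
    (hF : ∀ t, HasDerivAt F (2 * G t) t) (hc : 0 < c) (hGc : ∀ t, a ≤ t → c ≤ G t) :
    Tendsto F atTop atTop := by
  have hFc : Continuous F := continuous_iff_continuousAt.2 fun t => (hF t).continuousAt
  have hgrow : ∀ t, a ≤ t → 2 * c * (t - a) ≤ F t - F a := by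
    intro t ht
    refine (convex_Ici a).mul_sub_le_image_sub_of_le_deriv hFc.continuousOn
      (fun s _ => (hF s).differentiableAt.differentiableWithinAt) (fun s hs => ?_) a self_mem_Ici
      t ht ht
    rw [interior_Ici] at hs
    rw [(hF s).deriv]
    linarith [hGc s (le_of_lt hs)]
  have hlin : Tendsto (fun t => 2 * c * t + (F a - 2 * c * a)) atTop atTop :=
    tendsto_atTop_add_const_right _ _ (tendsto_id.const_mul_atTop (by positivity))
  refine tendsto_atTop_mono' atTop ?_ hlin
  filter_upwards [eventually_ge_atTop a] with t ht
  linarith [hgrow t ht]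

/-- **A far outgoing time.** If `F' = 2G`, `t₂ ≤ t₃` and `F t₂ < F t₃`, then some `r ≥ t₂` has
`F t₂ < F r` and `0 < G r`: take the last exit `s₀ = sup {s ∈ [t₂, t₃] : F s ≤ F t₂}`
(`IsCompact.sSup_mem`) and apply the mean value theorem on `[s₀, t₃]`. [folklore] -/
private theorem exists_far_outgoing {F G : ℝ → ℝ} (hF : ∀ t, HasDerivAt F (2 * G t) t) {t₂ t₃ : ℝ}
    (h23 : t₂ ≤ t₃) (hF23 : F t₂ < F t₃) : ∃ r, t₂ ≤ r ∧ F t₂ < F r ∧ 0 < G r := by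
  have hFc : Continuous F := continuous_iff_continuousAt.2 fun t => (hF t).continuousAt
  set S : Set ℝ := Icc t₂ t₃ ∩ {s | F s ≤ F t₂} with hS
  have hSc : IsCompact S := isCompact_Icc.inter_right (isClosed_le hFc continuous_const)
  have h2S : t₂ ∈ S := ⟨left_mem_Icc.2 h23, show F t₂ ≤ F t₂ from le_rfl⟩
  obtain ⟨⟨h20, h03⟩, hF0⟩ := hSc.sSup_mem ⟨t₂, h2S⟩
  have hF0 : F (sSup S) ≤ F t₂ := hF0
  have h03' : sSup S < t₃ := lt_of_le_of_ne h03 fun h => by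
    rw [h] at hF0
    exact absurd hF23 (not_lt.2 hF0)
  -- mean value theorem on `[sSup S, t₃]`
  obtain ⟨r, ⟨hr0, hr3⟩, hr⟩ :=
    exists_hasDerivAt_eq_slope F (fun t => 2 * G t) h03' hFc.continuousOn fun t _ => hF t
  have hGr : 0 < G r := by
    have h1 : 0 < (F t₃ - F (sSup S)) / (t₃ - sSup S) := div_pos (by linarith) (by linarith)
    rw [← hr] at h1
    linarith
  have hFr : F t₂ < F r := by
    by_contra hle
    have hrS : r ∈ S := ⟨⟨h20.trans hr0.le, hr3.le⟩, not_lt.1 hle⟩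
    have h1 : r ≤ sSup S := le_csSup hSc.bddAbove hrS
    linarith
  exact ⟨r, h20.trans hr0.le, hFr, hGr⟩

/-! ### The two uses of the hypotheses at late times -/

/-- **The ledger is nonnegative.** With a non-increasing ledger `E` on `[T, ∞)` that is
`κ (v² + μ/d)(μ/d)`-close to `v²/2 − μ/d`, bounded speed `v ≤ V` and recurrent dilation,
`E t ≥ 0` for every `t ≥ T`: compare with a later dilated time `t'`, `‖x t'‖ ≥ D'`, where
`E t' ≥ −μ/D' − κ (V² + μ/D')(μ/D')`, and let `D' → ∞`.  Step 1 of the escape argument (the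
only use of antitonicity). [cite: MarchalSaari1976, §1 (Lagrange–Jacobi)] -/
private theorem ledger_nonneg {μ V T κ : ℝ} {x : ℝ → E3} {E : ℝ → ℝ} (hμ : 0 < μ) (hκ : 0 ≤ κ)
    (hV : ∀ t, T ≤ t → ‖deriv x t‖ ≤ V) (hE : AntitoneOn E (Ici T))
    (hled : ∀ t, T ≤ t → |E t - (‖deriv x t‖ ^ 2 / 2 - μ / ‖x t‖)| ≤
      κ * (‖deriv x t‖ ^ 2 + μ / ‖x t‖) * (μ / ‖x t‖))
    (hrec : ∀ D' t₀ : ℝ, ∃ t, t₀ ≤ t ∧ D' ≤ ‖x t‖) {t : ℝ} (ht : T ≤ t) : 0 ≤ E t := by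
  by_contra hneg
  have hneg : E t < 0 := not_le.1 hneg
  set e := -E t with he
  have he0 : 0 < e := by linarith
  have hV0 : 0 ≤ V := (norm_nonneg _).trans (hV t ht)
  set k := 1 + κ * (V ^ 2 + μ) with hk
  have hk0 : 0 < k := by positivity
  -- a later dilated time `t'` with `‖x t'‖ ≥ D' := max 1 (μ k / e + 1)`
  obtain ⟨t', htt', hxD'⟩ := hrec (max 1 (μ * k / e + 1)) t
  have hT' : T ≤ t' := ht.trans htt'
  set d := ‖x t'‖ with hd
  have hd1 : 1 ≤ d := (le_max_left _ _).trans hxD'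
  have hd0 : 0 < d := one_pos.trans_le hd1
  have hdq : μ * k / e + 1 ≤ d := (le_max_right _ _).trans hxD'
  have hanti : E t' ≤ E t := hE (mem_Ici.2 ht) (mem_Ici.2 hT') htt'
  -- the ledger at `t'` is `≥ -k μ / d`
  set v := ‖deriv x t'‖ with hv
  set m := μ / d with hm
  have hm0 : 0 ≤ m := div_nonneg hμ.le hd0.le
  have hm1 : m ≤ μ := div_le_self hμ.le hd1
  have hv2 : v ^ 2 ≤ V ^ 2 := pow_le_pow_left₀ (norm_nonneg _) (hV t' hT') 2
  have h1 : (v ^ 2 / 2 - m) - κ * (v ^ 2 + m) * m ≤ E t' := by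
    have h := (abs_le.1 (hled t' hT')).1
    linarith
  have h2 : κ * (v ^ 2 + m) * m ≤ κ * (V ^ 2 + μ) * m :=
    mul_le_mul_of_nonneg_right (mul_le_mul_of_nonneg_left (by linarith) hκ) hm0
  have h3 : -(k * m) ≤ E t' := by
    rw [hk]
    nlinarith [h1, h2, sq_nonneg v]
  -- while `k μ / d ≤ μ k / (μ k / e + 1) < e = -E t ≤ -E t'`
  have h4 : k * m ≤ μ * k / (μ * k / e + 1) := by
    have hq0 : 0 < μ * k / e + 1 := by positivity
    calc k * m = μ * k / d := by rw [hm]; ring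
      _ ≤ μ * k / (μ * k / e + 1) := div_le_div_of_nonneg_left (by positivity) hq0 hdq
  have h5 : μ * k / (μ * k / e + 1) < e := by
    rw [div_lt_iff₀ (by positivity)]
    have h6 : e * (μ * k / e + 1) = μ * k + e := by field_simp
    rw [h6]
    linarith
  linarith [h3, h4, h5, hanti]

/-- **Lateness.** A curve of speed `≤ V` after `T` grows at most linearly, `‖x t‖ ≤ L t` for
`t ≥ max T 1` (mean value inequality), so an external forcing `β ≥ 0` with `t² β(t) → 0`
eventually satisfies `‖x t‖² β(t) ≤ μ/4`. [folklore] -/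
private theorem lateness {μ V T : ℝ} {x : ℝ → E3} {β : ℝ → ℝ} (hμ : 0 < μ)
    (hxd : Differentiable ℝ x) (hV : ∀ t, T ≤ t → ‖deriv x t‖ ≤ V)
    (hβ0 : ∀ t, T ≤ t → 0 ≤ β t) (hβ : Tendsto (fun t ↦ t ^ 2 * β t) atTop (𝓝 0)) :
    ∃ T₁, T ≤ T₁ ∧ ∀ t, T₁ ≤ t → ‖x t‖ ^ 2 * β t ≤ μ / 4 := by
  have hV0 : 0 ≤ V := (norm_nonneg _).trans (hV T le_rfl)
  set L := ‖x T‖ + |V * T| + V + 1 with hL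
  have hL0 : 0 < L := by positivity
  -- growth: `‖x t‖ ≤ ‖x T‖ + V (t - T) ≤ L t` for `t ≥ max T 1`
  have hgrow : ∀ t, T ≤ t → ‖x t‖ ≤ ‖x T‖ + V * (t - T) := by
    intro t ht
    have hmv : ‖x t - x T‖ ≤ V * ‖t - T‖ :=
      (convex_Ici T).norm_image_sub_le_of_norm_deriv_le (fun s _ => hxd s)
        (fun s hs => hV s hs) self_mem_Ici ht
    rw [Real.norm_eq_abs, abs_of_nonneg (sub_nonneg.2 ht)] at hmv
    calc ‖x t‖ = ‖x T + (x t - x T)‖ := by rw [add_sub_cancel]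
      _ ≤ ‖x T‖ + ‖x t - x T‖ := norm_add_le _ _
      _ ≤ ‖x T‖ + V * (t - T) := by linarith
  have hlin : ∀ t, max T 1 ≤ t → ‖x t‖ ≤ L * t := by
    intro t ht
    have hT : T ≤ t := (le_max_left _ _).trans ht
    have h1 : 1 ≤ t := (le_max_right _ _).trans ht
    have ha : ‖x T‖ ≤ ‖x T‖ * t := le_mul_of_one_le_right (norm_nonneg _) h1
    have hb : -(V * T) ≤ |V * T| * t :=
      (neg_le_abs _).trans (le_mul_of_one_le_right (abs_nonneg _) h1)
    have hc := hgrow t hT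
    rw [hL]
    nlinarith [ha, hb, hc, h1]
  -- `t² β t ≤ μ / (4 L²)` eventually
  have hpos : 0 < μ / (4 * L ^ 2) := by positivity
  obtain ⟨T₀, hT₀⟩ := eventually_atTop.1 (hβ.eventually (eventually_le_nhds hpos))
  refine ⟨max T₀ (max T 1), (le_max_left _ _).trans (le_max_right _ _), fun t ht => ?_⟩
  have h0 : T₀ ≤ t := (le_max_left _ _).trans ht
  have h1 : max T 1 ≤ t := (le_max_right _ _).trans ht
  have hT : T ≤ t := (le_max_left _ _).trans h1
  have hsq : ‖x t‖ ^ 2 ≤ (L * t) ^ 2 := pow_le_pow_left₀ (norm_nonneg _) (hlin t h1) 2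
  calc ‖x t‖ ^ 2 * β t ≤ (L * t) ^ 2 * β t := mul_le_mul_of_nonneg_right hsq (hβ0 t hT)
    _ = L ^ 2 * (t ^ 2 * β t) := by ring
    _ ≤ L ^ 2 * (μ / (4 * L ^ 2)) := mul_le_mul_of_nonneg_left (hT₀ t h0) (sq_nonneg _)
    _ = μ / 4 := by field_simp

end TwoBodyEscape

/-- **Stub S3: two-body escape** (stub `stub_twoBodyEscape` of line
`dilated-leaves-virial-certificate`, crux `Capture`, stmt-FinalStateConjecture-10115; verbatim the
registered signature).  A `C²` relative orbit `x : ℝ → ℝ³`, collision-free and of speed `≤ V` after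
`T`, obeying `‖ẍ + μ x/‖x‖³‖ ≤ κ (μ/‖x‖²)(‖ẋ‖² + μ/‖x‖) + β(t)` with `β ≥ 0`, `t² β(t) → 0`, with
an energy ledger `E` non-increasing on `[T, ∞)` and
`|E − (‖ẋ‖²/2 − μ/‖x‖)| ≤ κ (‖ẋ‖² + μ/‖x‖)(μ/‖x‖)`, and with `‖x‖ ≥ D'` at arbitrarily late
times for every `D'`, escapes: `‖x t‖ → ∞`.  Lagrange–Jacobi convexity: the ledger is `≥ 0`
(antitonicity + dilation), far states are unbound, `(‖x‖²)'' ≥ 0` in the far late region, so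
there is no far turning point after the first far outgoing time.
[cite: MarchalSaari1976, §1 (Lagrange–Jacobi)] -/
theorem stub_twoBodyEscape :
    ∀ (μ V T κ : ℝ) (x : ℝ → E3) (β E : ℝ → ℝ), 0 < μ → 0 ≤ κ → ContDiff ℝ 2 x →
      (∀ t, T ≤ t → x t ≠ 0) → (∀ t, T ≤ t → ‖deriv x t‖ ≤ V) →
      (∀ t, T ≤ t → 0 ≤ β t) → Tendsto (fun t ↦ t ^ 2 * β t) atTop (𝓝 0) →
      (∀ t, T ≤ t → ‖deriv (deriv x) t + (μ / ‖x t‖ ^ 3) • x t‖ ≤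
        κ * (μ / ‖x t‖ ^ 2 * (‖deriv x t‖ ^ 2 + μ / ‖x t‖)) + β t) →
      AntitoneOn E (Ici T) →
      (∀ t, T ≤ t → |E t - (‖deriv x t‖ ^ 2 / 2 - μ / ‖x t‖)| ≤
        κ * (‖deriv x t‖ ^ 2 + μ / ‖x t‖) * (μ / ‖x t‖)) →
      (∀ D' t₀ : ℝ, ∃ t, t₀ ≤ t ∧ D' ≤ ‖x t‖) →
      Tendsto (fun t ↦ ‖x t‖) atTop atTop := by
  intro μ V T κ x β E hμ hκ hx hx0 hV hβ0 hβ hforce hE hled hrec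
  -- (0) regularity: `F = ‖x‖²` has derivative `2G`, `G = ⟪x, ẋ⟫` has derivative `‖ẋ‖² + ⟪x, ẍ⟫`
  have hxd : Differentiable ℝ x := hx.differentiable (by norm_num)
  have hx'd : Differentiable ℝ (deriv x) := hx.differentiable_deriv_two
  have hF : ∀ t, HasDerivAt (fun s => ‖x s‖ ^ 2) (2 * ⟪x t, deriv x t⟫) t := fun t =>
    (hxd t).hasDerivAt.norm_sq
  have hG : ∀ t, HasDerivAt (fun s => ⟪x s, deriv x s⟫)
      (‖deriv x t‖ ^ 2 + ⟪x t, deriv (deriv x) t⟫) t :=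
    TwoBodyEscape.hasDerivAt_inner_deriv hxd hx'd
  -- (1) the ledger is nonnegative after `T`
  have hE0 : ∀ t, T ≤ t → 0 ≤ E t := fun t ht =>
    TwoBodyEscape.ledger_nonneg hμ hκ hV hE hled hrec ht
  -- (2)+(3) the Lagrange–Jacobi sign in the far (`‖x‖ > 10κμ`) late (`t ≥ T₁`) region
  obtain ⟨T₁, hTT₁, hlate⟩ := TwoBodyEscape.lateness hμ hxd hV hβ0 hβ
  have hconv : ∀ t, T₁ ≤ t → (10 * (κ * μ)) ^ 2 < ‖x t‖ ^ 2 →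
      0 ≤ ‖deriv x t‖ ^ 2 + ⟪x t, deriv (deriv x) t⟫ := by
    intro t ht hRt
    have hT : T ≤ t := hTT₁.trans ht
    have hfar : 10 * (κ * μ) ≤ ‖x t‖ := (lt_of_pow_lt_pow_left₀ 2 (norm_nonneg _) hRt).le
    have hd : 0 < ‖x t‖ := norm_pos_iff.2 (hx0 t hT)
    have hv : 3 / 2 * (μ / ‖x t‖) ≤ ‖deriv x t‖ ^ 2 :=
      TwoBodyEscape.speed_sq_lower hμ.le hd hfar (hE0 t hT) (hled t hT)
    exact TwoBodyEscape.inner_accel_nonneg hμ.le (hx0 t hT) hfar (hforce t hT) hv (hlate t ht)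
  -- (5) a far outgoing late time `r`: `‖x r‖ > 10κμ`, `⟪x r, ẋ r⟫ > 0`, `r ≥ T₁`
  obtain ⟨t₂, h12, hx2⟩ := hrec (10 * (κ * μ) + 1) T₁
  obtain ⟨t₃, h23, hx3⟩ := hrec (‖x t₂‖ + 1) t₂
  have hF23 : ‖x t₂‖ ^ 2 < ‖x t₃‖ ^ 2 := by nlinarith [norm_nonneg (x t₂), hx3]
  obtain ⟨r, h2r, hFr, hGr⟩ := TwoBodyEscape.exists_far_outgoing hF h23 hF23
  have hT₁r : T₁ ≤ r := h12.trans h2r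
  have hκμ : 0 ≤ 10 * (κ * μ) := by positivity
  have hRr : (10 * (κ * μ)) ^ 2 < ‖x r‖ ^ 2 := by
    refine lt_trans ?_ hFr
    nlinarith [hx2, hκμ]
  -- (4) no return after `r`, and escape of `‖x‖²`
  have hnr := TwoBodyEscape.no_return hF hG (fun t ht hRt => hconv t (hT₁r.trans ht) hRt) hRr hGr.le
  have hFtop : Tendsto (fun s => ‖x s‖ ^ 2) atTop atTop :=
    TwoBodyEscape.tendsto_atTop_of_deriv hF hGr fun t ht => (hnr t ht).1
  -- back to `‖x t‖ = √(‖x t‖²)`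
  have hsqrt : (fun t => ‖x t‖) = fun t => Real.sqrt (‖x t‖ ^ 2) :=
    funext fun t => (Real.sqrt_sq (norm_nonneg _)).symm
  rw [hsqrt]
  exact Real.tendsto_sqrt_atTop.comp hFtop

end Summit.FinalStateConjecture.FinalStateConjecture.Theorems.BartnikGapSettling.Capture
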